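import Summits.SmoothPoincare4.SmoothPoincare4.Theses.WeylBudget
import Summits.SmoothPoincare4.SmoothPoincare4.Theorems.WeylBudgetCorkRegluingBudgetStubInvolutiveCorkPresentation
import Summits.SmoothPoincare4.SmoothPoincare4.Theorems.WeylBudgetCorkRegluingBudgetStubIsometricRegluing
import Summits.SmoothPoincare4.SmoothPoincare4.Theorems.WeylBudgetCorkRegluingBudgetSymmetricGerm
import Summits.SmoothPoincare4.SmoothPoincare4.Theorems.WeylBudgetBudgetTransfer
import Summits.SmoothPoincare4.SmoothPoincare4.Theorems.WeylBudgetAssembly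
import Summits.SmoothPoincare4.Statement
import Literature.Topology.FourManifolds.CorkPresentationHomotopySphere

/-!
# Hardness certificate for the open stub B1b of crux `CorkRegluingBudget` (line `registered`)

Crux `Summit.SmoothPoincare4.SmoothPoincare4.Theses.WeylBudget.CorkRegluingBudget`
(stmt-SmoothPoincare4-10831, route WeylBudget), line `registered` = `Lines/birth.lean` RESHAPE 2
(sha d9d15a1c).  This file is EVIDENCE (a crux workfile), not a Theorems proposal: it kernel-checks
the claim of the lead analyses (c1 §3, c2) that the one open geometric stub
`stub_weylLightPscWithSymmetricGerm` (B1b) is SPC4-hard.  Precisely, with the B1b statement as a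
hypothesis (`StubB1b`, verbatim the registered signature) and the line's two named-fact stubs
(`Θ₄ = 0` and the involutive cork theorem) plus the route's named-fact item `ChangGurskyYang`
(CGY 2003 Thm A) as hypotheses, the SUMMIT statement `SmoothPoincare4` follows:

* `corkRegluingBudget_of_stubB1b : Θ₄=0 → involutiveCorkDecomposition → StubB1b → CorkRegluingBudget`
  (the skeleton `CorkRegluingBudget_of` in hypothesis form: Stub A from the two facts via the landed
  p148873, B1 from the landed B1a `symmetricGerm_of_involution` p151848 and B1b, B2 = landed
  `stub_isometricRegluing` p148994);
* `smoothPoincare4_of_stubB1b : Θ₄=0 → involutiveCorkDecomposition → ChangGurskyYang → StubB1b →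
  SmoothPoincare4` (then `budgetTransfer_proof` and `weylBudget_assembly_proof`).

So nothing short of the summit (modulo three published theorems) proves B1b.  The converse
`SmoothPoincare4 → CorkRegluingBudget` is `RestatesTarget.lean` (c1); `SmoothPoincare4 → StubB1b` is
NOT claimed (B1b is a statement about τ-symmetric PSC Weyl-light metrics on the standard sphere,
possibly strictly stronger than the summit — see `Lines/registered-lead-c2-analysis.md`).
Axioms: propext, Classical.choice, Quot.sound (no sorry).
-/

set_option linter.dupNamespace false

open scoped Manifold ContDiff Topology

noncomputable section

namespace Summit.SmoothPoincare4.SmoothPoincare4.Cruxes.CorkRegluingBudget.Hardness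

open Summit.SmoothPoincare4.SmoothPoincare4.Theorems
open Summit.SmoothPoincare4.SmoothPoincare4.Theorems.CorkRegluingBudget
open Summit.SmoothPoincare4.SmoothPoincare4.Theses.WeylBudget

/-- **The registered open stub B1b as a proposition** (verbatim the signature of
`stub_weylLightPscWithSymmetricGerm` in `Lines/birth.lean`, sha d9d15a1c): given a presentation
`jC, jW` of `S⁴ = C ∪_φ W` (`C` compact contractible), an involution `τ` of `∂C` and a τ-symmetric
germ `(g₁, U, Φ)` along the seam, there is a Riemannian `g` on `S⁴` with Levi-Civita connection,
`scal_g > 0`, `g.weylEnergy < 32π²` and an open `U' ⊆ U` containing the seam on which `Φ` is a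
`g`-isometry. -/
def StubB1b : Prop :=
    ∀ (C : Type) [TopologicalSpace C] [T2Space C] [SecondCountableTopology C]
      [ChartedSpace (EuclideanHalfSpace 4) C] [IsManifold (𝓡∂ 4) ∞ C] [CompactSpace C] [ContractibleSpace C]
      (bC : Literature.Topology.FourManifolds.BoundaryData (𝓡∂ 4) C (𝓡 3))
      (W : Type) [TopologicalSpace W] [T2Space W] [SecondCountableTopology W]
      [ChartedSpace (EuclideanHalfSpace 4) W] [IsManifold (𝓡∂ 4) ∞ W] [CompactSpace W]
      (bW : Literature.Topology.FourManifolds.BoundaryData (𝓡∂ 4) W (𝓡 3))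
      (φ : bC.carrier ≃ₘ⟮𝓡 3, 𝓡 3⟯ bW.carrier) (τ : bC.carrier ≃ₘ⟮𝓡 3, 𝓡 3⟯ bC.carrier)
      (jC : C → Metric.sphere (0 : EuclideanSpace ℝ (Fin 5)) 1)
      (jW : W → Metric.sphere (0 : EuclideanSpace ℝ (Fin 5)) 1)
      (g₁ : Literature.Geometry.Lorentzian.PseudoRiemannianMetric (𝓡 4) ∞ (EuclideanSpace ℝ (Fin 4))
          (TangentSpace (𝓡 4) : Metric.sphere (0 : EuclideanSpace ℝ (Fin 5)) 1 → Type _))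
      (U : Set (Metric.sphere (0 : EuclideanSpace ℝ (Fin 5)) 1))
      (Φ : Metric.sphere (0 : EuclideanSpace ℝ (Fin 5)) 1 → Metric.sphere (0 : EuclideanSpace ℝ (Fin 5)) 1),
      (∀ z, τ (τ z) = z) →
      Manifold.IsSmoothEmbedding (𝓡∂ 4) (𝓡 4) ∞ jC →
      Manifold.IsSmoothEmbedding (𝓡∂ 4) (𝓡 4) ∞ jW →
      Set.range jC ∪ Set.range jW = Set.univ →
      (∀ a b, jC a = jW b ↔ ∃ z, a = bC.incl z ∧ b = bW.incl (φ z)) →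
      g₁.IsRiemannian →
      IsOpen U →
      (∀ z, jC (bC.incl z) ∈ U) →
      ContMDiffOn (𝓡 4) (𝓡 4) ∞ Φ U →
      Set.MapsTo Φ U U →
      (∀ x ∈ U, Φ (Φ x) = x) →
      (∀ x ∈ U, Literature.Geometry.Lorentzian.pullbackBilin (I := 𝓡 4) (I' := 𝓡 4) Φ g₁.val x = g₁.val x) →
      (∀ x ∈ U, x ∈ Set.range jC → Φ x ∈ Set.range jC) →
      (∀ x ∈ U, x ∈ Set.range jW → Φ x ∈ Set.range jW) →
      (∀ z, Φ (jC (bC.incl z)) = jC (bC.incl (τ z))) →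
      ∃ (g : Literature.Geometry.Lorentzian.PseudoRiemannianMetric (𝓡 4) ∞ (EuclideanSpace ℝ (Fin 4))
          (TangentSpace (𝓡 4) : Metric.sphere (0 : EuclideanSpace ℝ (Fin 5)) 1 → Type _))
        (U' : Set (Metric.sphere (0 : EuclideanSpace ℝ (Fin 5)) 1)),
        g.IsRiemannian ∧
          (∃ _ : g.HasLeviCivita, (∀ x, 0 < g.scalarCurvature x) ∧
              g.weylEnergy < ENNReal.ofReal (32 * Real.pi ^ 2)) ∧
          IsOpen U' ∧ U' ⊆ U ∧
          (∀ z, jC (bC.incl z) ∈ U') ∧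
          (∀ x ∈ U', Literature.Geometry.Lorentzian.pullbackBilin (I := 𝓡 4) (I' := 𝓡 4) Φ g.val x = g.val x)

/-- **The crux from B1b and the two named facts** (the registered skeleton `CorkRegluingBudget_of`
with its three stubs as hypotheses): Stub A (involutive cork presentation of every homotopy
4-sphere) from `Θ₄ = 0` and the involutive cork theorem via the landed
`stub_involutiveCorkPresentation_of_facts` (p148873); on the standard sphere a τ-symmetric germ by
the landed `symmetricGerm_of_involution` (p151848), upgraded to a Weyl-light PSC metric with the
same local isometry by B1b; isometric regluing into `Σ` by the landed `stub_isometricRegluing`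
(p148994). [cite: KirbyCorks1996, Corollary p. 1] [cite: ChangGurskyYang2003, Thm A] -/
theorem corkRegluingBudget_of_stubB1b
    (hΘ : Literature.Topology.FourManifolds.isHCobordant_sphere_of_homotopySphere_four)
    (hK : Literature.Topology.FourManifolds.involutiveCorkDecomposition) (hB : StubB1b) :
    Summit.SmoothPoincare4.SmoothPoincare4.Theses.WeylBudget.CorkRegluingBudget := by
  intro S
  obtain ⟨C, tC, t2C, scC, chC, mC, cC, ctrC, bC, W, tW, t2W, scW, chW, mW, cW, bW, φ, τ, hτ,
    hS4, hSig⟩ := stub_involutiveCorkPresentation_of_facts hΘ hK S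
  obtain ⟨jC, jW, hjC, hjW, hcov, hseam⟩ := hS4
  obtain ⟨g₁, U, Φ, hg₁, hU, hYU, hΦs, hΦU, hΦΦ, hΦi, hΦg₁, hΦC, hΦW, hΦτ⟩ :=
    symmetricGerm_of_involution C bC W bW φ τ jC jW hτ hjC hjW hcov hseam
  obtain ⟨g, U', hg, ⟨hLC, hscal, hweyl⟩, hU', hU'U, hYU', hΦg⟩ :=
    hB C bC W bW φ τ jC jW g₁ U Φ hτ hjC hjW hcov hseam hg₁ hU hYU hΦs hΦU hΦΦ hΦg₁ hΦC hΦW hΦτ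
  obtain ⟨kC, kW, γ, hkC, hkW, hkcov, hkseam, hγ, hpC, hpW⟩ :=
    stub_isometricRegluing C bC W bW φ τ jC jW g U' Φ hjC hjW hcov hseam hg hU' hYU'
      (hΦs.mono hU'U) (hΦi.mono hU'U) hΦg (fun x hx h => hΦC x (hU'U hx) h)
      (fun x hx h => hΦW x (hU'U hx) h) hΦτ S.carrier hSig
  refine ⟨C, tC, chC, mC, W, tW, chW, mW, jC, jW, kC, kW, g, γ, cC, ctrC, hjC, hjW, hcov, ?_,
    hkC, hkW, hkcov, ?_, hpC, hpW, hg, hγ, hLC, hscal, hweyl⟩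
  · intro c v h
    obtain ⟨z, rfl, -⟩ := (hseam c v).1 h
    exact bC.incl_mem_boundary z
  · intro c v h
    obtain ⟨z, rfl, -⟩ := (hkseam c v).1 h
    exact bC.incl_mem_boundary z

/-- **B1b is SPC4-hard**: together with `Θ₄ = 0` (Kervaire–Milnor 1963), the involutive cork
theorem (Curtis–Freedman–Hsiang–Stong / Matveyev 1996, Kirby 1996 Addendum (D)) and
Chang–Gursky–Yang 2003 Thm A (the route's named-fact item `ChangGurskyYang`), the open stub B1b
implies the smooth 4-dimensional Poincaré conjecture: `CorkRegluingBudget` by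
`corkRegluingBudget_of_stubB1b`, then `WeylLight` by the proved `budgetTransfer_proof` and the summit
by the proved `weylBudget_assembly_proof`. [cite: ChangGurskyYang2003, Thm A]
[cite: KervaireMilnorAnnals1963, table p. 504] [cite: KirbyCorks1996, Theorem and Addendum (D)] -/
theorem smoothPoincare4_of_stubB1b
    (hΘ : Literature.Topology.FourManifolds.isHCobordant_sphere_of_homotopySphere_four)
    (hK : Literature.Topology.FourManifolds.involutiveCorkDecomposition)
    (hCGY : Summit.SmoothPoincare4.SmoothPoincare4.Theses.WeylBudget.ChangGurskyYang)
    (hB : StubB1b) : _root_.SmoothPoincare4 :=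
  weylBudget_assembly_proof hCGY (corkRegluingBudget_of_stubB1b hΘ hK hB) budgetTransfer_proof

end Summit.SmoothPoincare4.SmoothPoincare4.Cruxes.CorkRegluingBudget.Hardness

end
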